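import Literature.MathematicalPhysics.QuantumManyBody.PeriodicBoseGas
import Mathlib.Order.LiminfLimsup
import HarnessLib

/-!
# The second-order (Lee–Huang–Yang) upper bound for the dilute Bose gas: Basti–Cenatiempo–Schlein
# 2021, Theorem 1.1, and its fixed-density Dirichlet-box corollary

Topic `Literature/MathematicalPhysics/QuantumManyBody` (companion of `PeriodicBoseGas.lean`, next
to `LSSY2005_upperBound_periodic`; wanted by the crux `LhyOrderUpperBound`,
stmt-AtomisticToContinuum-6594, of route BECUvDepletionFloor).

G. Basti, S. Cenatiempo, B. Schlein, *A new second-order upper bound for the ground state energy of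
dilute Bose gases*, Forum Math. Sigma 9 (2021) e74, Theorem 1.1: for `V ∈ L³(ℝ³)` non-negative,
radial, with `supp V ⊂ B_R(0)` and scattering length `𝔞 (≤ R)`, the specific ground state energy
`e(ρ) = lim_{N, L → ∞, N/L³ = ρ} E(N, L)/L³` of `H_L = -∑ Δᵢ + ∑_{i<j} V(xᵢ - xⱼ)` on `L²_s(Λ_L^N)`,
`Λ_L = [-L/2, L/2]³`, **with Dirichlet boundary conditions** (units `m = 1/2`, `ħ = 1`, i.e. the
tree's `ħ = 2m = 1`), satisfies
`e(ρ) ≤ 4π ρ² 𝔞 [1 + (128/(15√π)) (ρ𝔞³)^{1/2}] + C ρ^{5/2 + 1/10}` for some `C > 0` and all `ρ`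
small enough.  (First proved for smooth `V` by Yau–Yin, J. Stat. Phys. 136 (2009), Thm. 1.1, with a
weaker rate; the matching lower bound is Fournais–Solovej, Ann. of Math. 192 (2020).)

## Contents

* `BCS2021_lhyUpperBound_dirichlet` (**named fact**, D-0014): Theorem 1.1 as printed, with the
  thermodynamic limit written as the `limsup` over `N` of `E(N, L_N)/L_N³` along the fixed-density
  sequence `L_N = (N/ρ)^{1/3}` (`sideLength ρ N`), `E(N, L)` being the tree's Dirichlet ground-state
  energy `groundStateEnergy v N L` (see Faithfulness).
* `lhyOrder_upperBound_dirichlet_of_BCS2021` (**proved**): the fixed-density finite-box form asked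
  for by the route — for `v` measurable, of finite range, integrable, bounded, with `a > 0`, there are
  `C, ρ₁ > 0` such that for `0 < ρ < ρ₁`, eventually in `N`,
  `E(N, (N/ρ)^{1/3}) ≤ 4π ρ a (1 + C √(ρa³)) N` — from the fact by absorbing `C ρ^{2.6}` into an
  order-`ρ^{5/2}` slack for `ρ < 1` (`C ρ^{13/5} < (C + 1) ρ^{5/2}`) and passing from a strict bound
  on the `limsup` to an eventual bound (`Filter.eventually_lt_of_limsup_lt`).  Its statement is
  token-identical to the route's `LhyOrderUpperBound`.
* Helper (proved): `lintegral_pow_three_ne_top_of_bounded` (bounded integrable `v` is in `L³`).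

## Faithfulness (source read: arXiv:2101.06222 = Forum Math. Sigma 9 (2021) e74, §1 pp. 1–3:
(1.1)–(1.3), Theorem 1.1 with its Remarks, Propositions 1.2–1.3; App. A (localisation), Lemma A.4;
store key `paper:arxiv-2101.06222`, chunks 3–4, 25–27)

* **The thermodynamic limit.** The paper defines `e(ρ)` as the *limit* (1.2) and uses "the
  existence of the thermodynamic limit of the specific energy and its convexity (see [Ruelle])"
  (App. A, before Lemma A.3).  Along the sequence `(N, L_N = (N/ρ)^{1/3})` — which is exactly the set
  of pairs with `N/L³ = ρ` — the printed bound on the limit is therefore a bound on the `limsup`,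
  which is what is vendored; no existence statement is smuggled in, and the vendored statement is
  implied by the print.
* **The Hamiltonian and `E(N, L)`.** `H_L = -∑Δᵢ + ∑V(xᵢ-xⱼ)` with Dirichlet conditions on
  `[-L/2, L/2]³`, ground state energy `E(N, L)` = bottom of the quadratic form, i.e. the infimum of
  `∫ |∇Ψ|² + ∑_{i<j} V |Ψ|²` over normalised symmetric `C_c^∞(Λ_L^N)` functions (a form core, as
  `V ≥ 0` is in `L³ ⊂ L^{3/2}_{loc}`), equivalently over the tree's `C¹` Dirichlet class `TrialState`
  (between `C_c^∞` and the form domain): this is `groundStateEnergy v N L` of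
  `BoseEinsteinCondensation.lean` on `(0, L)³` (translation invariance), in the same units
  `ħ = 2m = 1` and with the same scattering length (`-Δf + ½Vf = 0`, `8π𝔞 = ∫ V f`; LSSY App. C),
  `scatteringLength`.
* **Hypotheses on `V`.** "non-negative, radially symmetric" is automatic for a profile
  `v : ℝ → ℝ≥0∞` of `|x|`; "`V ∈ L³(ℝ³)`" is `∫ v(|x|)³ dx < ∞`; "`supp V ⊂ B_R(0)`" is `v(r) = 0` for
  `r ≥ R`; "scattering length `𝔞 ≤ R`" fixes notation and is automatic for such `V` (LSSY App. C,
  Remark after Lemma C.2: `a ≤ R₀`) — it is rendered as `𝔞 < ∞`, which is all that is needed to write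
  `a := 𝔞.toReal` and does not change the class of potentials; `Measurable v` is added so that the
  integrals are meaningful.  "for some `C > 0` and for `ρ` small enough": `∃ C ρ₀` after `v, R`
  (constants depending on `V`), the bound asserted for `0 < ρ < ρ₀`.
* Not vendored: Propositions 1.2 (localisation, App. A) and 1.3 (the grand-canonical periodic trial
  state), Yau–Yin's and Erdős–Schlein–Yau's earlier upper bounds, the hard-sphere version
  (Basti–Cenatiempo–Giuliani–Olgiati–Pasqualetti–Schlein 2024).

## References

* [BastiCenatiempoSchlein2021] G. Basti, S. Cenatiempo, B. Schlein, Forum Math. Sigma 9 (2021) e74,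
  doi:10.1017/fms.2021.66 (arXiv:2101.06222): (1.1)–(1.3), Theorem 1.1, Props. 1.2–1.3, App. A.
* [YauYin2009] H.-T. Yau, J. Yin, J. Stat. Phys. 136 (2009) 453–503, Thm. 1.1.
* [LSSY2005] E. H. Lieb, R. Seiringer, J. P. Solovej, J. Yngvason, *The Mathematics of the Bose Gas
  and its Condensation* (2005), §1.2, Ch. 2 (2.1)–(2.6), App. C.
-/

noncomputable section

open MeasureTheory Filter Metric
open scoped ENNReal NNReal

namespace Literature.MathematicalPhysics.QuantumManyBody.BoseGas

/-! ### The named fact -/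

/-- **Basti–Cenatiempo–Schlein 2021, Theorem 1.1** (the Lee–Huang–Yang formula as an upper bound):
"Let `V ∈ L³(ℝ³)` be non-negative, radially symmetric, with `supp(V) ⊂ B_R(0)` and scattering length
`𝔞 ≤ R`. Then, the specific ground state energy `e(ρ)` of the Hamilton operator `H_L` defined in (1.1)
satisfies `e(ρ) ≤ 4π ρ² 𝔞 [1 + (128/(15√π)) (ρ𝔞³)^{1/2}] + C ρ^{5/2 + 1/10}` for some `C > 0` and for
`ρ` small enough", where `H_L = -∑ᵢ Δᵢ + ∑_{i<j} V(xᵢ - xⱼ)` on `L²_s(Λ_L^N)`, `Λ_L = [-L/2, L/2]³`,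
"We assume Dirichlet boundary conditions and denote by `E(N, L)` the corresponding ground state
energy", and `e(ρ) = lim_{N, L → ∞, ρ = N/L³} E(N, L)/L³` (1.2) ("since Dirichlet boundary conditions
lead to the largest energy, the upper bound holds in fact for arbitrary boundary conditions",
Remark).  Rendered (see the module docstring): for a measurable profile `v : ℝ → [0, ∞]` vanishing on
`[R, ∞)`, with `∫ v(|x|)³ dx < ∞` and finite scattering length `a`, there are `C` and `ρ₀ > 0` such
that for all `0 < ρ < ρ₀`,
`limsup_{N → ∞} E₀(N, L_N)/L_N³ ≤ 4π ρ² a (1 + (128/(15√π)) √(ρa³)) + C ρ^{5/2+1/10}`,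
`L_N = (N/ρ)^{1/3}` (`sideLength`), `E₀ = groundStateEnergy` (Dirichlet, units `ħ = 2m = 1`).
A deep THEOREM (Bogoliubov trial states in Fock space on periodic boxes of side `ρ^{-γ}`, `γ > 1`,
Prop. 1.3, and localisation, Prop. 1.2); not in Mathlib. Named fact (D-0014).
[cite: BastiCenatiempoSchlein2021, Thm. 1.1 and (1.1)–(1.2)] [cite: YauYin2009, Thm. 1.1] -/
def BCS2021_lhyUpperBound_dirichlet : Prop :=
  ∀ (v : ℝ → ℝ≥0∞) (R : ℝ), Measurable v → (∀ r, R ≤ r → v r = 0) →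
    (∫⁻ x : Space, v ‖x‖ ^ 3) ≠ ⊤ → scatteringLength v ≠ ⊤ →
  ∃ C ρ₀ : ℝ, 0 < ρ₀ ∧ ∀ ρ : ℝ, 0 < ρ → ρ < ρ₀ →
    let a := (scatteringLength v).toReal
    Filter.limsup (fun N : ℕ => groundStateEnergy v N (sideLength ρ N) /
        ENNReal.ofReal (sideLength ρ N ^ 3)) Filter.atTop ≤
      ENNReal.ofReal (4 * Real.pi * ρ ^ 2 * a *
          (1 + 128 / (15 * Real.sqrt Real.pi) * Real.sqrt (ρ * a ^ 3)) +
        C * ρ ^ (5 / 2 + 1 / 10 : ℝ))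

/-! ### Helpers -/

/-- A bounded integrable profile is in `L³`: `∫ v(|x|)³ dx ≤ C² ∫ v(|x|) dx < ∞`. [folklore] -/
theorem lintegral_pow_three_ne_top_of_bounded {v : ℝ → ℝ≥0∞} {C : ℝ}
    (hC : ∀ r, v r ≤ ENNReal.ofReal C) (hint : (∫⁻ x : Space, v ‖x‖) ≠ ⊤) :
    (∫⁻ x : Space, v ‖x‖ ^ 3) ≠ ⊤ := by
  have hle : ∀ x : Space, v ‖x‖ ^ 3 ≤ ENNReal.ofReal C ^ 2 * v ‖x‖ := fun x => by
    calc v ‖x‖ ^ 3 = v ‖x‖ * v ‖x‖ * v ‖x‖ := by ring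
      _ ≤ ENNReal.ofReal C * ENNReal.ofReal C * v ‖x‖ := by gcongr <;> exact hC _
      _ = ENNReal.ofReal C ^ 2 * v ‖x‖ := by ring
  refine ne_top_of_le_ne_top ?_ (lintegral_mono hle)
  rw [lintegral_const_mul' _ _ (by simp)]
  exact ENNReal.mul_ne_top (by simp) hint

/-! ### The fixed-density Dirichlet-box corollary -/

/-- **Order-`√(ρa³)` upper bound at fixed density in Dirichlet boxes** (the form of the route's
`LhyOrderUpperBound`), from Basti–Cenatiempo–Schlein's Theorem 1.1: for a measurable, finite-range,
integrable and bounded pair potential `v ≥ 0` with scattering length `a > 0` there are `C` and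
`ρ₁ > 0` such that for every `0 < ρ < ρ₁`, for all sufficiently large `N`, the Dirichlet ground-state
energy of `N` bosons in the box of side `(N/ρ)^{1/3}` satisfies
`E₀(N, (N/ρ)^{1/3}) ≤ 4π ρ a (1 + C √(ρa³)) N`.  Proof: bounded and integrable gives `V ∈ L³`
(`lintegral_pow_three_ne_top_of_bounded`) and `a < ∞` (`scatteringLength_ne_top`); with `C'` the
constant of the fact and `C = 128/(15√π) + (C'₊ + 1)/(4π a √(a³))`, for `ρ < min(ρ₀, 1)` one has
`4πρ²a(1 + (128/(15√π))√(ρa³)) + C' ρ^{13/5} < 4πρ²a(1 + C√(ρa³))` (as `ρ^{13/5} ≤ ρ^{5/2}`), so the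
`limsup` of `E₀(N, L_N)/L_N³` is strictly below the right side and the bound holds eventually
(`Filter.eventually_lt_of_limsup_lt`), and `L_N³ = N/ρ`.
[cite: BastiCenatiempoSchlein2021, Thm. 1.1] -/
theorem lhyOrder_upperBound_dirichlet_of_BCS2021 (h : BCS2021_lhyUpperBound_dirichlet) :
    ∀ v : ℝ → ℝ≥0∞, IsRepulsiveFiniteRange v → (∫⁻ x : Space, v ‖x‖) ≠ ⊤ →
      (∃ C : ℝ, ∀ r, v r ≤ ENNReal.ofReal C) → 0 < scatteringLength v →
      ∃ C ρ₁ : ℝ, 0 < ρ₁ ∧ ∀ ρ : ℝ, 0 < ρ → ρ < ρ₁ → ∀ᶠ N : ℕ in Filter.atTop,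
        groundStateEnergy v N (sideLength ρ N) ≤
          ENNReal.ofReal (4 * Real.pi * ρ * (scatteringLength v).toReal *
            (1 + C * Real.sqrt (ρ * (scatteringLength v).toReal ^ 3)) * N) := by
  intro v hv hint hbdd hapos
  obtain ⟨hmeas, R₀, hR₀⟩ := hv
  obtain ⟨Cv, hCv⟩ := hbdd
  have hL3 : (∫⁻ x : Space, v ‖x‖ ^ 3) ≠ ⊤ := lintegral_pow_three_ne_top_of_bounded hCv hint
  have hatop : scatteringLength v ≠ ⊤ := by
    refine scatteringLength_ne_top ?_
    rw [lintegral_const_mul' _ _ (by simp)]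
    exact ENNReal.mul_ne_top (by simp) hint
  have hrange : ∀ r, R₀ + 1 ≤ r → v r = 0 := fun r hr => hR₀ r (by linarith)
  obtain ⟨C, ρ₀, hρ₀, hC⟩ := h v (R₀ + 1) hmeas hrange hL3 hatop
  set a : ℝ := (scatteringLength v).toReal with ha_def
  have ha : 0 < a := ENNReal.toReal_pos hapos.ne' hatop
  have ha3 : 0 < Real.sqrt (a ^ 3) := Real.sqrt_pos.2 (by positivity)
  set c₀ : ℝ := 128 / (15 * Real.sqrt Real.pi) with hc₀
  have hc₀pos : 0 < c₀ := by rw [hc₀]; positivity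
  set K : ℝ := (max C 0 + 1) / (4 * Real.pi * a * Real.sqrt (a ^ 3)) with hK
  have hKpos : 0 < K := by rw [hK]; positivity
  refine ⟨c₀ + K, min ρ₀ 1, lt_min hρ₀ one_pos, fun ρ hρ hρ1 => ?_⟩
  have hρρ₀ : ρ < ρ₀ := hρ1.trans_le (min_le_left _ _)
  have hρ1' : ρ < 1 := hρ1.trans_le (min_le_right _ _)
  have hlim := hC ρ hρ hρρ₀
  simp only at hlim
  -- the two right-hand sides and the strict slack between them
  set s : ℝ := Real.sqrt (ρ * a ^ 3) with hs
  have hs0 : 0 ≤ s := Real.sqrt_nonneg _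
  have hs_eq : s = Real.sqrt ρ * Real.sqrt (a ^ 3) := by rw [hs, Real.sqrt_mul hρ.le]
  set B : ℝ := 4 * Real.pi * ρ ^ 2 * a * (1 + c₀ * s) + C * ρ ^ (5 / 2 + 1 / 10 : ℝ) with hB
  set B' : ℝ := 4 * Real.pi * ρ ^ 2 * a * (1 + (c₀ + K) * s) with hB'
  have hmain : 4 * Real.pi * ρ ^ 2 * a * (K * s) = (max C 0 + 1) * (ρ ^ 2 * Real.sqrt ρ) := by
    rw [hs_eq, hK]
    field_simp
  have hpow : C * ρ ^ (5 / 2 + 1 / 10 : ℝ) < (max C 0 + 1) * (ρ ^ 2 * Real.sqrt ρ) := by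
    have h52 : ρ ^ 2 * Real.sqrt ρ = ρ ^ (5 / 2 : ℝ) := by
      rw [Real.sqrt_eq_rpow, ← Real.rpow_natCast, ← Real.rpow_add hρ]
      norm_num
    have hle : ρ ^ (5 / 2 + 1 / 10 : ℝ) ≤ ρ ^ (5 / 2 : ℝ) :=
      Real.rpow_le_rpow_of_exponent_ge hρ hρ1'.le (by norm_num)
    have hpos : 0 < ρ ^ (5 / 2 : ℝ) := Real.rpow_pos_of_pos hρ _
    rw [h52]
    calc C * ρ ^ (5 / 2 + 1 / 10 : ℝ) ≤ max C 0 * ρ ^ (5 / 2 + 1 / 10 : ℝ) :=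
          mul_le_mul_of_nonneg_right (le_max_left _ _) (Real.rpow_nonneg hρ.le _)
      _ ≤ max C 0 * ρ ^ (5 / 2 : ℝ) := mul_le_mul_of_nonneg_left hle (le_max_right _ _)
      _ < (max C 0 + 1) * ρ ^ (5 / 2 : ℝ) := by nlinarith
  have hBB' : B < B' := by
    have : B' = 4 * Real.pi * ρ ^ 2 * a * (1 + c₀ * s) + 4 * Real.pi * ρ ^ 2 * a * (K * s) := by
      rw [hB']; ring
    rw [this, hmain, hB]
    linarith
  have hB'pos : 0 < B' := by rw [hB']; positivity
  -- from the `limsup` to an eventual strict bound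
  have hlt : Filter.limsup (fun N : ℕ => groundStateEnergy v N (sideLength ρ N) /
      ENNReal.ofReal (sideLength ρ N ^ 3)) Filter.atTop < ENNReal.ofReal B' :=
    hlim.trans_lt ((ENNReal.ofReal_lt_ofReal_iff hB'pos).2 hBB')
  filter_upwards [Filter.eventually_lt_of_limsup_lt hlt, Filter.eventually_gt_atTop 0] with N hN hN0
  have hL3eq : sideLength ρ N ^ 3 = N / ρ := by
    -- `L_N³ = ((N/ρ)^{1/3})³ = N/ρ` (cf. `div_sideLength_pow_three`)
    have h0 : (0 : ℝ) ≤ N / ρ := div_nonneg (Nat.cast_nonneg N) hρ.le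
    rw [sideLength, ← Real.rpow_natCast, ← Real.rpow_mul h0]
    norm_num
  have hL3pos : 0 < sideLength ρ N ^ 3 := by
    rw [hL3eq]; exact div_pos (Nat.cast_pos.2 hN0) hρ
  have hne0 : ENNReal.ofReal (sideLength ρ N ^ 3) ≠ 0 := (ENNReal.ofReal_pos.2 hL3pos).ne'
  rw [ENNReal.div_lt_iff (Or.inl hne0) (Or.inl ENNReal.ofReal_ne_top),
    ← ENNReal.ofReal_mul hB'pos.le] at hN
  refine hN.le.trans (le_of_eq ?_)
  congr 1
  rw [hB', hL3eq]
  field_simp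

end Literature.MathematicalPhysics.QuantumManyBody.BoseGas

end
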